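import Summits.Ventures.PackingBounds.Energy.FivePointRieszTwoUnique
import Summits.Ventures.PackingBounds.Energy.FivePointRieszTwoOptimal
import Summits.Ventures.PackingBounds.Energy.FivePointBipyramidIsometry
import HarnessLib

/-!
# Five points on `S²`, Riesz 2-energy: the ground state is unique up to isometry

Framing: lottery ticket; floor = certified bounds/negative ranges. Venture `PackingBounds`, cell
`pub-packcert`, energy family E3PT (pub-packcert-energy gen 11).

Assembly of the kernel-checked sharp three-point certificates (`thomson_five_points`,
`riesz_two_five_points`), their complementary-slackness rigidity (`thomson_five_points_rigid`,
`riesz_two_five_points_rigid`) and the Gram-matrix isometry lemma (`Bipyramid5.isometric`):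
every minimiser of the Coulomb energy (Thomson's problem, five electrons) or of the Riesz 2-energy among
five points of `S²` is the image of the explicit triangular bipyramid `Config.Bipyramid.pts` under a
linear isometry of `ℝ³`; any two minimisers are isometric. (R. E. Schwartz, Exp. Math. 22 (2013), proved
the Coulomb case by a computer-assisted subdivision; here both follow from exact SDP certificates.)
-/

noncomputable section

open Finset
open scoped RealInnerProductSpace

namespace Summit.Ventures.PackingBounds.Energy

open Summit.Ventures.PackingBounds.Config

/-- **Riesz 2-energy of five points, uniqueness:** any two minimisers (`Σ_{x≠y} 1/‖x-y‖² = 17/2`) are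
related by a linear isometry of `ℝ³`. -/
theorem FivePointRieszTwo.minimisers_isometric (C C' : Finset (EuclideanSpace ℝ (Fin 3)))
    (hC : ∀ x ∈ C, ‖x‖ = 1) (h5 : C.card = 5)
    (hmin : ∑ x ∈ C, ∑ y ∈ C.erase x, 1 / ‖x - y‖ ^ 2 = 17 / 2)
    (hC' : ∀ x ∈ C', ‖x‖ = 1) (h5' : C'.card = 5)
    (hmin' : ∑ x ∈ C', ∑ y ∈ C'.erase x, 1 / ‖x - y‖ ^ 2 = 17 / 2) :
    ∃ Ψ : EuclideanSpace ℝ (Fin 3) ≃ₗᵢ[ℝ] EuclideanSpace ℝ (Fin 3), C' = C.image Ψ :=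
  Bipyramid5.isometric C C' hC h5 (FivePointRieszTwo.riesz_two_five_points_rigid C hC h5 hmin).2.2
    hC' h5' (FivePointRieszTwo.riesz_two_five_points_rigid C' hC' h5' hmin').2.2

/-- **Riesz 2-energy of five points, the ground state:** every minimiser is the image of
`Config.Bipyramid.pts` under a linear isometry of `ℝ³`. -/
theorem FivePointRieszTwo.ground_state_unique (C : Finset (EuclideanSpace ℝ (Fin 3)))
    (hC : ∀ x ∈ C, ‖x‖ = 1) (h5 : C.card = 5)
    (hmin : ∑ x ∈ C, ∑ y ∈ C.erase x, 1 / ‖x - y‖ ^ 2 = 17 / 2) :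
    ∃ Ψ : EuclideanSpace ℝ (Fin 3) ≃ₗᵢ[ℝ] EuclideanSpace ℝ (Fin 3), C = Bipyramid.pts.image Ψ :=
  FivePointRieszTwo.minimisers_isometric Bipyramid.pts C Bipyramid.norm_pts Bipyramid.card_pts
    FivePointRieszTwo.bipyramid_riesz_two_energy hC h5 hmin

end Summit.Ventures.PackingBounds.Energy
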